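import Summits.AtomisticToContinuum.Crystallization.Theorems.ChargedEnergyGapSlimBasis
import HarnessLib

/-!
# NODE 113H «SlimPack» — packed column codes and the compact Montante path for 113G slim bases

Two byte/kernel refinements of 113G «SlimBasis» (tree (221)) for the (T¹ᶜ) certificate files, DEF-ONLY, soundness untouched
(the output is the same ordinary 110B `BasisCert`; 110E `invCheck` / `cornerCheck` still verify every expanded basis):

* `pkc n` decodes ONE numeral `n = 48·k + 8·g + s` to the 110B column reference `⟨k, g, s⟩`, and `bsx a b c d e f` is a slim basis by
  six codes — a basis costs ≈ 32 bytes in a certificate file instead of ≈ 90 (`⟨⟨k, g, s⟩, …⟩`) or ≈ 740 (a full `BasisCert`).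
* `gjInverseC` is the COMPACT fraction-free Montante–Bareiss inversion: a row is `(original index, live left entries, right entries
  in pivot order)`; cleared left columns are dropped and right columns are created only when their pivot appears (an untouched
  identity column holds the running pivot on its own row and `0` elsewhere), so step `j` touches `6` entries per row instead of `12`
  (measured: 0.078 s per basis in the kernel vs 0.10 s for 113G `gjInverseZ`).  `BasisIdx.expandC` / `expandAllC` use it.

Contents: `cmStep`, `cmLoop`, `pivPos`, `gjInverseC`, `BasisIdx.expandC`, `expandAllC`, `pkc`, `bsx`; `decide +kernel` sanity checks;
`BasisIdx.expandC_c₀`.  No instance, no notation, no `Prop`-valued definition.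
-/

namespace Summit.AtomisticToContinuum.Crystallization.Theorems.ChargedEnergyGapChartDial

/-! ## §113H.1 The compact Montante scheme -/

/-- One compact Montante step: pivot = first row of `rest` whose leading live entry is nonzero; every other row `(i, x :: L, G)` becomes
`(i, (piv•L − x•Lₚ)/prev, (piv•G − x•Gₚ)/prev ++ [−x])`, the pivot row becomes `(iₚ, Lₚ.tail, Gₚ ++ [prev])`; returns `(done', rest', piv)`. -/
def cmStep (prev : ℤ) (done rest : List (ℕ × List ℤ × List ℤ)) : Option (List (ℕ × List ℤ × List ℤ) × List (ℕ × List ℤ × List ℤ) × ℤ) :=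
  let rec split : List (ℕ × List ℤ × List ℤ) → Option ((ℕ × List ℤ × List ℤ) × List (ℕ × List ℤ × List ℤ) × List (ℕ × List ℤ × List ℤ))
    | [] => none
    | r :: rs => if r.2.1.headD 0 ≠ 0 then some (r, [], rs) else
        match split rs with
        | none => none
        | some (p, pre, post) => some (p, r :: pre, post)
  match split rest with
  | none => none
  | some (p, pre, post) =>
    let piv := p.2.1.headD 0
    let Lp := p.2.1.tail
    let Gp := p.2.2
    let clear := fun r : ℕ × List ℤ × List ℤ =>
      let x := r.2.1.headD 0
      (r.1, List.zipWith (fun a b => (piv * a - x * b) / prev) r.2.1.tail Lp,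
        List.zipWith (fun a b => (piv * a - x * b) / prev) r.2.2 Gp ++ [-x])
    some (done.map clear ++ [(p.1, Lp, Gp ++ [prev])], (pre ++ post).map clear, piv)

/-- Compact Montante loop over `n` columns: `some (rows in pivot order, last pivot d)` or `none` if singular. -/
def cmLoop : ℕ → ℤ → List (ℕ × List ℤ × List ℤ) → List (ℕ × List ℤ × List ℤ) → Option (List (ℕ × List ℤ × List ℤ) × ℤ)
  | 0, prev, done, rest => if rest.isEmpty then some (done, prev) else none
  | n + 1, prev, done, rest =>
    match cmStep prev done rest with
    | none => none
    | some (done', rest', piv) => cmLoop n piv done' rest'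

/-- Position of `c` in a list of naturals (`length` if absent). -/
def pivPos (c : ℕ) : List ℕ → ℕ
  | [] => 0
  | d :: ds => if d = c then 0 else pivPos c ds + 1

/-- ★ The exact inverse of a square rational matrix through the compact integer scheme: scale by the common denominator `D`
(113G `slimLcmDen`), run `cmLoop` from `(i, D•row_i, [])`, read `A⁻¹[m][c] = D • G_m[pos c] / d` where `pos c` is the pivot position
of original row `c`; `none` if singular. -/
def gjInverseC (M : List (List ℚ)) : Option (List (List ℚ)) :=
  let n := M.length
  let D : ℤ := slimLcmDen M.flatten
  let rows : List (ℕ × List ℤ × List ℤ) := (List.range n).zipWith (fun i r => (i, r.map (fun x : ℚ => (x * (D : ℚ)).num), [])) M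
  match cmLoop n 1 [] rows with
  | none => none
  | some (done, d) =>
    let perm := done.map (fun r => r.1)
    some (done.map (fun r => (List.range n).map (fun c => Rat.divInt (r.2.2.getD (pivPos c perm) 0 * D) d)))

/-- sanity: the compact path inverts `[[2, 1], [1, 1]]` to `[[1, -1], [-1, 2]]`. -/
theorem gjInverseC_example : gjInverseC [[2, 1], [1, 1]] = some [[1, -1], [-1, 2]] := by decide +kernel

/-- sanity: compact path = 113G reference Gauss–Jordan on a `3×3` needing a row swap. -/
theorem gjInverseC_example3 :
    gjInverseC [[0, 1/3, 1], [1/2, 0, 1/4], [2, 5, 1]] = gjInverse [[0, 1/3, 1], [1/2, 0, 1/4], [2, 5, 1]] := by decide +kernel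

/-- sanity: a singular matrix has no compact inverse. -/
theorem gjInverseC_singular : gjInverseC [[1, 2], [2, 4]] = none := by decide +kernel

/-! ## §113H.2 Expansion through the compact path -/

/-- ★ EXPANSION (compact path): as 113G `BasisIdx.expand` with `gjInverseC` in place of `gjInverseZ`. -/
def BasisIdx.expandC (B : BasisIdx) : BasisCert :=
  match (match B.mat? with | none => none | some M => gjInverseC M) with
  | some inv => ⟨B.c₀, B.c₁, B.c₂, B.c₃, B.c₄, B.c₅, slimRowFun (inv.getD 0 []), slimRowFun (inv.getD 1 []), slimRowFun (inv.getD 2 []),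
      slimRowFun (inv.getD 3 []), slimRowFun (inv.getD 4 []), slimRowFun (inv.getD 5 [])⟩
  | none => ⟨B.c₀, B.c₁, B.c₂, B.c₃, B.c₄, B.c₅, 0, 0, 0, 0, 0, 0⟩

/-- Compact expansion of a list of slim bases (the `bases` field of a 110E `StationCert` / 113F `CellPart`). -/
def expandAllC (Bs : List BasisIdx) : List BasisCert := Bs.map BasisIdx.expandC

/-- The expanded certificate keeps the column references. -/
theorem BasisIdx.expandC_c₀ (B : BasisIdx) : B.expandC.c₀ = B.c₀ := by
  unfold BasisIdx.expandC; split <;> rfl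

/-! ## §113H.3 Packed column codes -/

/-- PACKED column reference: the code `48·k + 8·g + s` of `⟨k, g, s⟩` (one short numeral per column in certificate files). -/
def pkc (n : ℕ) : ColRef := ⟨n / 48, ⟨n / 8 % 6, Nat.mod_lt _ (by decide)⟩, ⟨n % 8, Nat.mod_lt _ (by decide)⟩⟩

/-- sanity: `pkc (48·17 + 8·4 + 5)` is column `⟨17, 4, 5⟩`. -/
theorem pk_example : (pkc 853).k = 17 ∧ (pkc 853).g = 4 ∧ (pkc 853).s = 5 := by decide +kernel

/-- A slim basis by six packed column codes (certificate-file constructor). -/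
def bsx (a b c d e f : ℕ) : BasisIdx := ⟨pkc a, pkc b, pkc c, pkc d, pkc e, pkc f⟩

/-- sanity: a packed basis of Cb1k8 expands (compact path) to rows that pass 110E `invCheck`. -/
theorem bx_example : (bsx 3890 3895 288 3894 6448 6456).expandC.invCheck = true := by decide +kernel

end Summit.AtomisticToContinuum.Crystallization.Theorems.ChargedEnergyGapChartDial
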